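import Summits.QuantumFields.BalabanUV.Beta.WilsonDivergenceContact
import Summits.QuantumFields.BalabanUV.Beta.RecursiveStencilSlot
import Summits.QuantumFields.BalabanUV.Beta.SymmetrisedStepJets
import Summits.QuantumFields.BalabanUV.Beta.RelInvComposite
import Summits.QuantumFields.BalabanUV.Beta.CompositeCorrectorBordered
import Summits.QuantumFields.BalabanUV.Beta.KernelWardLevels
import Summits.QuantumFields.BalabanUV.Beta.NVertexSectors
import Summits.QuantumFields.BalabanUV.Beta.SymShiftedSpread

/-!
# `BalabanUV.Beta.CompositeStencilWardReduction` — row D1 ∕ (C1), the `hW𝒯 j` END's stencil Ward letter (S)_j at the COMPOSITE bordered operator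
# `bhKcomp`: THE THREE SECTORS, AND THE REDUCTION OF (S)_j TO ONE V-BORDER LAW AGAINST THE ROOTED-PLAIN COMPOSITE ROWS (PART 104)

HONEST DEPENDENCY (page 1, mandatory): continuum YM on T⁴ ⇐ BetaPertH ∧ nine spine estimates (0/9 proved); BetaPertH ⇐ (D1) ∧ (D4) ∧ CAP+tail;
G-an2-4 gates asym, D1 and NE2/3/4.  HONEST FRAMING (cell contract, verbatim): «discharging `BetaPertH` makes Bałaban's UV stability UNCONDITIONAL —
a real constructive-QFT result; it is NOT the continuum limit and NOT the Clay problem.»  ABSOLUTE RULE (cell charter, verbatim): «No internally-minted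
statement may enter as a cited fact. Every hypothesis is either kernel-proved in this package or a verbatim quotation of a PUBLISHED theorem with page
reference. The manuscript(s) under audit are NOT citable for their own disputed steps — they are the thing under adjudication; programme-internal
(2001/route/tribunal) claims are never citable.»

WHY (row-D1 owner an2 gen 86, FINDING AN2-86-1, memo `gen86/HSD-SCOPING.md`).  PART 103 `TowerNWardOfTableLaws.wardTransversal_AN_of_tableLaws` reduced the
(3a) END's last F-side display `hW𝒯 j` to the composite TABLES' Ward laws; its (S)-side hypothesis is
`hSd : ∀ y, cH • Σ_{v ∈ box 4 N} divV (JNat R P (j+1)).S (N•y + toSite v) = conjV (bhKcomp R.rc Lc (j+1)) (X y)`, `N = Lc^(j+1)`, `cH = (N⁴)⁻¹`.  The stencil is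
`(JNat R P m).S = S0NOf 3 (Lc^m) (tabsComp …).V (tabsComp …).H (P.cE m) (P.cVH m) (P.cΛ m)` (an2 `NVertexSectors.JNat_S_eq_S0NOf`, `rfl`), so its divergence has three sectors (§1, the twin of leaf-10's
`WardLocusS0N.divV_S0NAt` for GENERIC tables): the Λ-sector is NULL (`WardLocusStencils.divV_SLam_lamCoeffOf_eq_zero` — `d*d ∘ d = 0` on the flat column), the Wilson
sector is leaf-05's contact against the field–field window of the bordered operator, and the V-sector is the tables' own.  Against `M := bhKcomp rc L m = Φ̂ᵀ ∘ bhK (L^m) ∘ Φ̂`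
(an2 `RelInvComposite`), whose four blocks are the cross-lane leaf's theorems `CompositeCorrectorBordered.trK_phiK_bhK_phiK_*` — field–field = `bhK`'s (`d*d` does not see the
corrector), border = the ROOTED-PLAIN composite rows `compLinAvgAt rc L m`, multiplier–multiplier = `0` — the Wilson sector CLOSES at the lock `cH·cE/2 = ξ` with the diagonal
generator (§2–§3), and **(S)_j holds iff the V-table obeys ONE border law against the rooted-plain composite rows** (§3 `hSd_S0NOf_iff_borderLaw`, §4 at `bhKcomp`,
§4 at the tower's `(JNat R P m).S`).  §3 prints that border commutator entrywise (the rows are `compLinAvgAt rc L m δ`, by name).  The record's `tabsComp` V-table is built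
from the (0.4)-SYM bricks (`CompositeOneShotJets.compV`), whose own Ward law is the commutator of the SYM rows — the located seam of FINDING AN2-86-1 (PREDICTION-AN2-86a);
this file asserts nothing about it: the border law is displayed, never proved.

WHAT: [folklore] finite kernel algebra BY NAME over the tree's objects; no `def`, no `def … : Prop`, nothing cited, 0 sorry.  Nothing of Bałaban's asserted, valued or
discharged; 0 estimates; 0∕4 row-D1 binders; (S)(W) NOT claimed; NOT (C1), NOT D1, NEVER «G-an2-4 closed», NOT BetaPertH, NOT continuum, NOT Clay.
Row D1 ∕ (C1) OWNER «beta-an2», gen 86, 2026-08-30.  No existing file touched.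
-/

noncomputable section

open Finset
open scoped BigOperators
open Literature.Probability.LatticeModels (Torus.proj)
open Literature.MathematicalPhysics.QuantumFieldTheory
open Literature.MathematicalPhysics.QuantumFieldTheory.Balaban1983to89
open Literature.MathematicalPhysics.QuantumFieldTheory.Balaban1983to89.Beta
open ExpKernelCalculus (MKer Decays VertexFamily comp)
open OneStepResolventKernel (Fib KInv)
open KernelWard (divV)
open StepJetData (wilsonA)
open AffineAveraging (box toSite)
open InterLevelTransport (SLam)
open BalabanStepJets (lamCoeffOf)
open KKTFluctuationKernel (delta1)
open LatticeForm (quo)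
open Summit.QuantumFields.BalabanUV.Beta.TameKernelCalculus (Loc trK)
open Summit.QuantumFields.BalabanUV.Beta.ChartConjugation (conjV)
open Summit.QuantumFields.BalabanUV.Beta.BorderedHessian (bhK bhKAt diagK diagK_apply conjV_diagK_apply comp_axEc_diagK_comm)
open Summit.QuantumFields.BalabanUV.Beta.AxialDressingRooted (axEc one_le_of_neZero)
open Summit.QuantumFields.BalabanUV.Beta.AveragingWardRootedStencils (legInd legInd_inl legInd_inr)
open Summit.QuantumFields.BalabanUV.Beta.SpineRooted (S0NOf)
open Summit.QuantumFields.BalabanUV.Beta.WardLocusStencils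
open Summit.QuantumFields.BalabanUV.Beta.WardLocusS0N (conjV_diagK_smul conjV_diagK_sum)
open Summit.QuantumFields.BalabanUV.Beta.WilsonDivergenceContact (sum_divV_wilsonA_eq_conjV)
open Summit.QuantumFields.BalabanUV.Beta.KernelWardLevels (loc_diagK_smul_sum_legInd)
open Summit.QuantumFields.BalabanUV.Beta.SymmetrisedStepJets (SymTables)
open Summit.QuantumFields.BalabanUV.Beta.RelInvComposite (bhKcomp bhKcomp_eq)
open Summit.QuantumFields.BalabanUV.Beta.CompositeCorrectorBordered (trK_phiK_bhK_phiK_inl_inl trK_phiK_bhK_phiK_inr_inl trK_phiK_bhK_phiK_inl_inr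
  trK_phiK_bhK_phiK_inr_inr)
open Summit.QuantumFields.BalabanUV.Beta.CompositeAveragingCoarseExact (compLinAvgAt)
open Summit.QuantumFields.BalabanUV.Beta.CompositeOneShotJets (tabsComp compV compH tabsComp_H)
open Summit.QuantumFields.BalabanUV.Beta.CompositeOneShotJetData (Roots Pins JNat)
open Summit.QuantumFields.BalabanUV.Beta.SymShiftedSpread (conjV_add_diagK)
open Summit.QuantumFields.BalabanUV.Beta.NVertexSectors (JNat_S_eq_S0NOf)

namespace Summit.QuantumFields.BalabanUV.Beta.CompositeStencilWardReduction

variable {d : ℕ}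

/-! ## §1 The three sectors of the slotted native spine's divergence (generic tables) -/

section Sectors

variable {N : ℕ} [NeZero N]

/-- [folklore] **THE DIVERGENCE OF THE SLOTTED `j = 0` SPINE HAS NO Λ-PART**, for ANY border table `V` and any Hessian table `H` localised at every rate:
`divV (S0NOf d N V H cE cVH cΛ) u = cE • divV wilsonA u + cVH • divV V u` (Λ-null: `divV_SLam_lamCoeffOf_eq_zero` at `A := KInv N`, `decays_KInv`; twin of
`WardLocusS0N.divV_S0NAt`). -/
theorem divV_S0NOf (V H : Fin (d + 1) → (Fin (d + 1) → ℤ) → MKer (d + 1) (Fib d)) (hH : ∀ δ : ℝ, 0 ≤ δ → ∃ C : ℝ, VertexFamily H N C δ)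
    (cE cVH cΛ : ℝ) (u : Fin (d + 1) → ℤ) :
    divV (S0NOf d N V H cE cVH cΛ) u = cE • divV (wilsonA d) u + cVH • divV V u := by
  obtain ⟨δ₀, C, hδ₀, hC, hdec⟩ := OneStepResolventKernel.decays_KInv (N := N) (d := d)
  obtain ⟨Cq, hQ⟩ := hH δ₀ hδ₀.le
  have hΛ := divV_SLam_lamCoeffOf_eq_zero (N := N) hdec hC hδ₀ hQ u
  funext x z a b
  have hΛ' := congr_fun (congr_fun (congr_fun (congr_fun hΛ x) z) a) b
  simp only [divV_apply, Pi.zero_apply, Finset.sum_sub_distrib] at hΛ'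
  simp only [divV_apply, Pi.add_apply, Pi.smul_apply, smul_eq_mul, S0NOf, Finset.sum_add_distrib, Finset.sum_sub_distrib,
    ← Finset.mul_sum]
  linear_combination cΛ * hΛ'

/-- [folklore] The same for a table record `tabs : SymTables d N` (its (LH) letter `tabs.hH` feeds the Λ-null). -/
theorem divV_S0NOf_tabs (tabs : SymTables d N) (cE cVH cΛ : ℝ) (u : Fin (d + 1) → ℤ) :
    divV (S0NOf d N tabs.V tabs.H cE cVH cΛ) u = cE • divV (wilsonA d) u + cVH • divV tabs.V u :=
  divV_S0NOf tabs.V tabs.H tabs.hH cE cVH cΛ u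

end Sectors

/-! ## §2 The diagonal contact of a bordered operator splits into its field–field window and its border -/

section Split

variable {N : ℕ} [NeZero N]

/-- [folklore] **WINDOW + BORDER**: `conjV M (diagK g) = conjV (ffK M) (diagK g) + conjV (M − ffK M) (diagK g)` (additivity in the operator: an2
`SymShiftedSpread.conjV_add_diagK`). -/
theorem conjV_diagK_eq_ffK_add_border (M : MKer (d + 1) (Fib d)) (g : (Fin (d + 1) → ℤ) → Fib d → ℝ) :
    conjV M (diagK g) = conjV (ffK M) (diagK g) + conjV (M - ffK M) (diagK g) := by
  rw [← conjV_add_diagK, add_sub_cancel]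

/-- [folklore] **THE SOCKET `hSd` SPLIT INTO ITS SECTORS, GENERIC TABLES, ANY BORDERED OPERATOR `M` WHOSE FIELD–FIELD WINDOW IS `bhK`'s.**
For `S = S0NOf d N V H cE cVH cΛ` (H localised at every rate), `ffK M = ffK (bhK N)` and the diagonal generator with symbol `ξ • Σ_{v ∈ box} legInd ρ (N•y + v)`:
`cH • Σ_v divV S (N•y+v) − conjV M (diagK (ξ • Σ_v legInd ρ (N•y+v)))`
`= [(cH·cE) • Σ_v divV wilsonA (N•y+v) − ξ • Σ_v conjV (ffK (bhKAt d ρ N)) (diagK (legInd ρ (N•y+v)))] + [(cH·cVH) • Σ_v divV V (N•y+v) − ξ • Σ_v conjV (M − ffK M) (diagK (legInd ρ (N•y+v)))]`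
(twin of leaf-10's `hSd_defect_S0NAt`; `ffK (bhKAt d ρ N) = ffK (bhK N)`, `ffK_bhKAt`). -/
theorem hSd_defect_S0NOf (V H : Fin (d + 1) → (Fin (d + 1) → ℤ) → MKer (d + 1) (Fib d)) (hH : ∀ δ : ℝ, 0 ≤ δ → ∃ C : ℝ, VertexFamily H N C δ)
    {M : MKer (d + 1) (Fib d)} (hM : ffK M = ffK (bhK (d := d) N)) (ρ : Fin (d + 1) → ℤ) (cE cVH cΛ cH ξ : ℝ) (y : Fin (d + 1) → ℤ) :
    cH • ∑ v ∈ box (d + 1) N, divV (S0NOf d N V H cE cVH cΛ) ((N : ℤ) • y + toSite v) -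
        conjV M (diagK (ξ • ∑ v ∈ box (d + 1) N, legInd ρ ((N : ℤ) • y + toSite v))) =
      ((cH * cE) • ∑ v ∈ box (d + 1) N, divV (wilsonA d) ((N : ℤ) • y + toSite v) -
          ξ • ∑ v ∈ box (d + 1) N, conjV (ffK (bhKAt d ρ N)) (diagK (legInd ρ ((N : ℤ) • y + toSite v)))) +
        ((cH * cVH) • ∑ v ∈ box (d + 1) N, divV V ((N : ℤ) • y + toSite v) -
          ξ • ∑ v ∈ box (d + 1) N, conjV (M - ffK M) (diagK (legInd ρ ((N : ℤ) • y + toSite v)))) := by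
  rw [conjV_diagK_smul, conjV_diagK_sum]
  simp only [divV_S0NOf V H hH, conjV_diagK_eq_ffK_add_border M, hM, ffK_bhKAt ρ N, Finset.sum_add_distrib, Finset.smul_sum, smul_add,
    smul_smul]
  funext x z a b
  simp only [Pi.add_apply, Pi.sub_apply, Pi.smul_apply, Finset.sum_apply, smul_eq_mul]
  ring

omit [NeZero N] in
/-- [folklore] **THE WILSON SECTOR CLOSES AT THE LOCK** `cH·cE·½ = ξ` (leaf-05's contact law `sum_divV_wilsonA_eq_conjV`, constant `½`): the first bracket of
`hSd_defect_S0NOf` vanishes. -/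
theorem wilson_bracket_eq_zero (ρ : Fin (d + 1) → ℤ) {cE cH ξ : ℝ} (h₁ : cH * cE * (1 / 2) = ξ) (y : Fin (d + 1) → ℤ) :
    (cH * cE) • ∑ v ∈ box (d + 1) N, divV (wilsonA d) ((N : ℤ) • y + toSite v) -
        ξ • ∑ v ∈ box (d + 1) N, conjV (ffK (bhKAt d ρ N)) (diagK (legInd ρ ((N : ℤ) • y + toSite v))) = 0 := by
  rw [sum_divV_wilsonA_eq_conjV (box (d + 1) N) (fun v => (N : ℤ) • y + toSite v) ρ N, conjV_diagK_sum, smul_smul, h₁, sub_self]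

/-- [folklore] **(S)_j ⟺ ONE V-BORDER LAW** (generic tables; any `M` with `ffK M = ffK (bhK N)`; at the Wilson lock `cH·cE·½ = ξ`):
`cH • Σ_v divV (S0NOf d N V H cE cVH cΛ) (N•y+v) = conjV M (diagK (ξ • Σ_v legInd ρ (N•y+v)))`
`↔ (cH·cVH) • Σ_v divV V (N•y+v) = ξ • Σ_v conjV (M − ffK M) (diagK (legInd ρ (N•y+v)))`. -/
theorem hSd_S0NOf_iff_borderLaw (V H : Fin (d + 1) → (Fin (d + 1) → ℤ) → MKer (d + 1) (Fib d)) (hH : ∀ δ : ℝ, 0 ≤ δ → ∃ C : ℝ, VertexFamily H N C δ)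
    {M : MKer (d + 1) (Fib d)} (hM : ffK M = ffK (bhK (d := d) N)) (ρ : Fin (d + 1) → ℤ) {cE cH ξ : ℝ} (cVH cΛ : ℝ) (h₁ : cH * cE * (1 / 2) = ξ)
    (y : Fin (d + 1) → ℤ) :
    cH • ∑ v ∈ box (d + 1) N, divV (S0NOf d N V H cE cVH cΛ) ((N : ℤ) • y + toSite v) =
        conjV M (diagK (ξ • ∑ v ∈ box (d + 1) N, legInd ρ ((N : ℤ) • y + toSite v))) ↔
      (cH * cVH) • ∑ v ∈ box (d + 1) N, divV V ((N : ℤ) • y + toSite v) =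
        ξ • ∑ v ∈ box (d + 1) N, conjV (M - ffK M) (diagK (legInd ρ ((N : ℤ) • y + toSite v))) := by
  rw [← sub_eq_zero, hSd_defect_S0NOf V H hH hM ρ cE cVH cΛ cH ξ y, wilson_bracket_eq_zero ρ h₁ y, zero_add, sub_eq_zero]

/-- [folklore] **(S)_j FROM THE V-BORDER LAW** (the `→` direction, in the END's shape `∀ y`). -/
theorem hSd_S0NOf_of_borderLaw (V H : Fin (d + 1) → (Fin (d + 1) → ℤ) → MKer (d + 1) (Fib d)) (hH : ∀ δ : ℝ, 0 ≤ δ → ∃ C : ℝ, VertexFamily H N C δ)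
    {M : MKer (d + 1) (Fib d)} (hM : ffK M = ffK (bhK (d := d) N)) (ρ : Fin (d + 1) → ℤ) {cE cH ξ : ℝ} (cVH cΛ : ℝ) (h₁ : cH * cE * (1 / 2) = ξ)
    (hV : ∀ y : Fin (d + 1) → ℤ, (cH * cVH) • ∑ v ∈ box (d + 1) N, divV V ((N : ℤ) • y + toSite v) =
      ξ • ∑ v ∈ box (d + 1) N, conjV (M - ffK M) (diagK (legInd ρ ((N : ℤ) • y + toSite v)))) (y : Fin (d + 1) → ℤ) :
    cH • ∑ v ∈ box (d + 1) N, divV (S0NOf d N V H cE cVH cΛ) ((N : ℤ) • y + toSite v) =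
      conjV M (diagK (ξ • ∑ v ∈ box (d + 1) N, legInd ρ ((N : ℤ) • y + toSite v))) :=
  (hSd_S0NOf_iff_borderLaw V H hH hM ρ cVH cΛ h₁ y).2 (hV y)

end Split

/-! ## §3 The composite bordered operator `bhKcomp rc L m`: field–field window = `bhK (L^m)`'s; its border = the ROOTED-PLAIN composite rows (entrywise) -/

section Composite

variable (r : ℕ → (Fin (d + 1) → ℕ)) {L : ℕ} (hL : 0 < L) (m : ℕ)
include hL

/-- [folklore] **`ffK (bhKcomp rc L m) = ffK (bhK (L^m))`** — the corrector does not see `d*d` (`CompositeCorrectorBordered.trK_phiK_bhK_phiK_inl_inl`). -/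
theorem ffK_bhKcomp : ffK (bhKcomp r L m) = ffK (bhK (d := d) (L ^ m)) := by
  funext x z a b
  rcases a with κ | κ <;> rcases b with l | l
  · rw [ffK_inl_inl, ffK_inl_inl, bhKcomp_eq, trK_phiK_bhK_phiK_inl_inl r m hL]
  · rw [ffK_inl_inr, ffK_inl_inr]
  · rw [ffK_inr_inl, ffK_inr_inl]
  · rw [ffK_inr_inr, ffK_inr_inr]

omit hL in
/-- [folklore] The border of `bhKcomp`: field–field entry `0`. -/
theorem border_bhKcomp_inl_inl (x z : Fin (d + 1) → ℤ) (κ β : Fin (d + 1)) :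
    (bhKcomp r L m - ffK (bhKcomp r L m)) x z (Sum.inl κ) (Sum.inl β) = 0 := by
  rw [Pi.sub_apply, Pi.sub_apply, Pi.sub_apply, Pi.sub_apply, ffK_inl_inl, sub_self]

omit hL in
/-- [folklore] The border of `bhKcomp`: multiplier–multiplier entry `0`. -/
theorem border_bhKcomp_inr_inr (x z : Fin (d + 1) → ℤ) (μ₀ μ : Fin (d + 1)) :
    (bhKcomp r L m - ffK (bhKcomp r L m)) x z (Sum.inr μ₀) (Sum.inr μ) = 0 := by
  rw [Pi.sub_apply, Pi.sub_apply, Pi.sub_apply, Pi.sub_apply, ffK_inr_inr, sub_zero, bhKcomp_eq, trK_phiK_bhK_phiK_inr_inr]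

/-- [folklore] **THE BORDER OF `bhKcomp`, MULTIPLIER–FIELD: THE ROOTED-PLAIN COMPOSITE ROW** `[proj x = 0]·(compLinAvgAt rc L m δ_{(β,z)})_κ(x∕n)`. -/
theorem border_bhKcomp_inr_inl (x z : Fin (d + 1) → ℤ) (κ β : Fin (d + 1)) :
    (bhKcomp r L m - ffK (bhKcomp r L m)) x z (Sum.inr κ) (Sum.inl β) =
      if Torus.proj (L ^ m) x = 0 then compLinAvgAt r L m (delta1 β z) κ (quo (L ^ m) x) else 0 := by
  rw [Pi.sub_apply, Pi.sub_apply, Pi.sub_apply, Pi.sub_apply, ffK_inr_inl, sub_zero, bhKcomp_eq, trK_phiK_bhK_phiK_inr_inl r m hL]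

/-- [folklore] **THE BORDER OF `bhKcomp`, FIELD–MULTIPLIER: MINUS THE TRANSPOSED ROOTED-PLAIN COMPOSITE ROW.** -/
theorem border_bhKcomp_inl_inr (x z : Fin (d + 1) → ℤ) (α μ : Fin (d + 1)) :
    (bhKcomp r L m - ffK (bhKcomp r L m)) x z (Sum.inl α) (Sum.inr μ) =
      if Torus.proj (L ^ m) z = 0 then -(compLinAvgAt r L m (delta1 α x) μ (quo (L ^ m) z)) else 0 := by
  rw [Pi.sub_apply, Pi.sub_apply, Pi.sub_apply, Pi.sub_apply, ffK_inl_inr, sub_zero, bhKcomp_eq, trK_phiK_bhK_phiK_inl_inr r m hL]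

/-- [folklore] **THE BORDER COMMUTATOR WITH THE DIAGONAL LEG GENERATOR, MULTIPLIER–FIELD ENTRY**: the rooted-plain composite row times the leg-indicator jump
`[z = u] − [x + ρ = u]` (a field leg acts at its site, a multiplier leg at its root). -/
theorem conjV_border_bhKcomp_legInd_inr_inl (ρ u x z : Fin (d + 1) → ℤ) (κ β : Fin (d + 1)) :
    conjV (bhKcomp r L m - ffK (bhKcomp r L m)) (diagK (legInd ρ u)) x z (Sum.inr κ) (Sum.inl β) =
      (if Torus.proj (L ^ m) x = 0 then compLinAvgAt r L m (delta1 β z) κ (quo (L ^ m) x) else 0) *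
        ((if z = u then (1 : ℝ) else 0) - (if x + ρ = u then (1 : ℝ) else 0)) := by
  rw [conjV_diagK_apply, border_bhKcomp_inr_inl r hL m, legInd_inl, legInd_inr]

/-- [folklore] The same, field–multiplier entry. -/
theorem conjV_border_bhKcomp_legInd_inl_inr (ρ u x z : Fin (d + 1) → ℤ) (α μ : Fin (d + 1)) :
    conjV (bhKcomp r L m - ffK (bhKcomp r L m)) (diagK (legInd ρ u)) x z (Sum.inl α) (Sum.inr μ) =
      (if Torus.proj (L ^ m) z = 0 then -(compLinAvgAt r L m (delta1 α x) μ (quo (L ^ m) z)) else 0) *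
        ((if z + ρ = u then (1 : ℝ) else 0) - (if x = u then (1 : ℝ) else 0)) := by
  rw [conjV_diagK_apply, border_bhKcomp_inl_inr r hL m, legInd_inl, legInd_inr]

omit hL in
/-- [folklore] The border commutator vanishes on the field–field block … -/
theorem conjV_border_bhKcomp_legInd_inl_inl (ρ u x z : Fin (d + 1) → ℤ) (κ β : Fin (d + 1)) :
    conjV (bhKcomp r L m - ffK (bhKcomp r L m)) (diagK (legInd ρ u)) x z (Sum.inl κ) (Sum.inl β) = 0 := by
  rw [conjV_diagK_apply, border_bhKcomp_inl_inl r m, zero_mul]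

omit hL in
/-- [folklore] … and on the multiplier–multiplier block. -/
theorem conjV_border_bhKcomp_legInd_inr_inr (ρ u x z : Fin (d + 1) → ℤ) (μ₀ μ : Fin (d + 1)) :
    conjV (bhKcomp r L m - ffK (bhKcomp r L m)) (diagK (legInd ρ u)) x z (Sum.inr μ₀) (Sum.inr μ) = 0 := by
  rw [conjV_diagK_apply, border_bhKcomp_inr_inr r m, zero_mul]

variable [NeZero (L ^ m)]

/-- [folklore] **(S) AT `bhKcomp` ⟺ THE V-BORDER LAW AGAINST THE ROOTED-PLAIN COMPOSITE ROWS** (generic tables at blocking `L^m`; Wilson lock `cH·cE·½ = ξ`). -/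
theorem hSd_S0NOf_bhKcomp_iff_borderLaw (V H : Fin (d + 1) → (Fin (d + 1) → ℤ) → MKer (d + 1) (Fib d))
    (hH : ∀ δ : ℝ, 0 ≤ δ → ∃ C : ℝ, VertexFamily H (L ^ m) C δ) (ρ : Fin (d + 1) → ℤ) {cE cH ξ : ℝ} (cVH cΛ : ℝ) (h₁ : cH * cE * (1 / 2) = ξ)
    (y : Fin (d + 1) → ℤ) :
    cH • ∑ v ∈ box (d + 1) (L ^ m), divV (S0NOf d (L ^ m) V H cE cVH cΛ) (((L ^ m : ℕ) : ℤ) • y + toSite v) =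
        conjV (bhKcomp r L m) (diagK (ξ • ∑ v ∈ box (d + 1) (L ^ m), legInd ρ (((L ^ m : ℕ) : ℤ) • y + toSite v))) ↔
      (cH * cVH) • ∑ v ∈ box (d + 1) (L ^ m), divV V (((L ^ m : ℕ) : ℤ) • y + toSite v) =
        ξ • ∑ v ∈ box (d + 1) (L ^ m), conjV (bhKcomp r L m - ffK (bhKcomp r L m)) (diagK (legInd ρ (((L ^ m : ℕ) : ℤ) • y + toSite v))) :=
  hSd_S0NOf_iff_borderLaw V H hH (ffK_bhKcomp r hL m) ρ cVH cΛ h₁ y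

/-- [folklore] **(S) AT `bhKcomp` FROM THE V-BORDER LAW**, in the END's shape. -/
theorem hSd_S0NOf_bhKcomp_of_borderLaw (V H : Fin (d + 1) → (Fin (d + 1) → ℤ) → MKer (d + 1) (Fib d))
    (hH : ∀ δ : ℝ, 0 ≤ δ → ∃ C : ℝ, VertexFamily H (L ^ m) C δ) (ρ : Fin (d + 1) → ℤ) {cE cH ξ : ℝ} (cVH cΛ : ℝ) (h₁ : cH * cE * (1 / 2) = ξ)
    (hV : ∀ y : Fin (d + 1) → ℤ, (cH * cVH) • ∑ v ∈ box (d + 1) (L ^ m), divV V (((L ^ m : ℕ) : ℤ) • y + toSite v) =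
      ξ • ∑ v ∈ box (d + 1) (L ^ m), conjV (bhKcomp r L m - ffK (bhKcomp r L m)) (diagK (legInd ρ (((L ^ m : ℕ) : ℤ) • y + toSite v))))
    (y : Fin (d + 1) → ℤ) :
    cH • ∑ v ∈ box (d + 1) (L ^ m), divV (S0NOf d (L ^ m) V H cE cVH cΛ) (((L ^ m : ℕ) : ℤ) • y + toSite v) =
      conjV (bhKcomp r L m) (diagK (ξ • ∑ v ∈ box (d + 1) (L ^ m), legInd ρ (((L ^ m : ℕ) : ℤ) • y + toSite v))) :=
  hSd_S0NOf_of_borderLaw V H hH (ffK_bhKcomp r hL m) ρ cVH cΛ h₁ hV y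

end Composite

/-! ## §4 At the tower: PART 103's (S)-side at `(JNat R P m).S` reduced to the border law of the record's V-table `compV R.r Lc m` -/

section Tower

variable {Lc : ℕ} [NeZero Lc] (R : Roots Lc) (P : Pins)

/-- [folklore] **(S)_j AT THE TOWER ⟺ THE BORDER LAW OF THE RECORD's COMPOSITE V-TABLE AGAINST THE ROOTED-PLAIN COMPOSITE ROWS OF `bhKcomp R.rc Lc m`**
(depth `m`, diagonal generator rooted at `ρ`, Wilson lock `cH·cE m·½ = ξ`; every `R`, `P`). -/
theorem hSd_JNat_iff_borderLaw (m : ℕ) (ρ : Fin (3 + 1) → ℤ) {cH ξ : ℝ} (h₁ : cH * P.cE m * (1 / 2) = ξ) (y : Fin (3 + 1) → ℤ) :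
    cH • ∑ v ∈ box (3 + 1) (Lc ^ m), divV (JNat R P m).S (((Lc ^ m : ℕ) : ℤ) • y + toSite v) =
        conjV (bhKcomp (d := 3) R.rc Lc m) (diagK (ξ • ∑ v ∈ box (3 + 1) (Lc ^ m), legInd ρ (((Lc ^ m : ℕ) : ℤ) • y + toSite v))) ↔
      (cH * P.cVH m) • ∑ v ∈ box (3 + 1) (Lc ^ m), divV (compV R.r Lc m) (((Lc ^ m : ℕ) : ℤ) • y + toSite v) =
        ξ • ∑ v ∈ box (3 + 1) (Lc ^ m), conjV (bhKcomp (d := 3) R.rc Lc m - ffK (bhKcomp (d := 3) R.rc Lc m))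
          (diagK (legInd ρ (((Lc ^ m : ℕ) : ℤ) • y + toSite v))) := by
  rw [JNat_S_eq_S0NOf R P m]
  exact hSd_S0NOf_bhKcomp_iff_borderLaw R.rc (Nat.pos_of_ne_zero (NeZero.ne Lc)) m (compV R.r Lc m) (compH R.r Lc m)
    (by rw [← tabsComp_H m (one_le_of_neZero Lc) R.hr (P.cM m)]; exact (tabsComp m (one_le_of_neZero Lc) R.hr (P.cM m)).hH) ρ (P.cVH m) (P.cΛ m) h₁ y

/-- [folklore] **PART 103's (S)-SIDE FROM THE BORDER LAW**: given the V-border law at depth `j+1` (generator rooted at `ρ`, lock `cH·cE·½ = ξ`), the three (S)-side data of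
`TowerNWardOfTableLaws.wardTransversal_AN_of_tableLaws` — a localised generator commuting with `axEc (toSite (R.s (j+1))) (Lc^(j+1))` and the law `hSd` at `bhKcomp` — are
supplied with `X y := diagK (ξ • Σ_v legInd ρ (N•y + v))` (`loc_diagK_smul_sum_legInd`, `comp_axEc_diagK_comm`). -/
theorem sSide_of_borderLaw (j : ℕ) (ρ : Fin (3 + 1) → ℤ) {cH ξ : ℝ} (h₁ : cH * P.cE (j + 1) * (1 / 2) = ξ)
    (hV : ∀ y : Fin (3 + 1) → ℤ,
      (cH * P.cVH (j + 1)) • ∑ v ∈ box (3 + 1) (Lc ^ (j + 1)), divV (compV R.r Lc (j + 1)) (((Lc ^ (j + 1) : ℕ) : ℤ) • y + toSite v) =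
        ξ • ∑ v ∈ box (3 + 1) (Lc ^ (j + 1)), conjV (bhKcomp (d := 3) R.rc Lc (j + 1) - ffK (bhKcomp (d := 3) R.rc Lc (j + 1)))
          (diagK (legInd ρ (((Lc ^ (j + 1) : ℕ) : ℤ) • y + toSite v)))) :
    (∀ y, Loc (diagK (ξ • ∑ v ∈ box (3 + 1) (Lc ^ (j + 1)), legInd ρ (((Lc ^ (j + 1) : ℕ) : ℤ) • y + toSite v)))) ∧
      (∀ y, comp (axEc (toSite (R.s (j + 1))) (Lc ^ (j + 1))) (diagK (ξ • ∑ v ∈ box (3 + 1) (Lc ^ (j + 1)), legInd ρ (((Lc ^ (j + 1) : ℕ) : ℤ) • y + toSite v))) =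
        comp (diagK (ξ • ∑ v ∈ box (3 + 1) (Lc ^ (j + 1)), legInd ρ (((Lc ^ (j + 1) : ℕ) : ℤ) • y + toSite v))) (axEc (toSite (R.s (j + 1))) (Lc ^ (j + 1)))) ∧
      (∀ y, cH • ∑ v ∈ box (3 + 1) (Lc ^ (j + 1)), divV (JNat R P (j + 1)).S (((Lc ^ (j + 1) : ℕ) : ℤ) • y + toSite v) =
        conjV (bhKcomp (d := 3) R.rc Lc (j + 1)) (diagK (ξ • ∑ v ∈ box (3 + 1) (Lc ^ (j + 1)), legInd ρ (((Lc ^ (j + 1) : ℕ) : ℤ) • y + toSite v)))) :=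
  ⟨fun y => loc_diagK_smul_sum_legInd (Lc ^ (j + 1)) ρ ξ y, fun _ => comp_axEc_diagK_comm _ _ _,
    fun y => (hSd_JNat_iff_borderLaw R P (j + 1) ρ h₁ y).2 (hV y)⟩

end Tower

end Summit.QuantumFields.BalabanUV.Beta.CompositeStencilWardReduction

end
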